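import Literature.Topology.FourManifolds.TrisectionsTopFaceFunction
import HarnessLib

/-!
# The zero set of the gap function is connected: it is swept out by an upper level

Topic `Literature/Topology/FourManifolds`; step G (part e) of a Morse-theoretic construction of
Gay–Kirby's trisection for the fact seat
`provefact-Literature.Topology.FourManifolds.exists_isBalancedGKTrisection` (Gay–Kirby 2016,
Thm. 4 via §4, Lemma 14).  Everything in this file is **proved**; no definitions.

Let `N = {γ = 0}` be the regular zero set of the gap function `γ = s - T` (the closed
`3`-manifold containing the top face `X₂ ∩ X₃`, `TrisectionsTopFaceLevel.lean`) and let
`Y' = f⁻¹(a + ℓ)` be a level in the band above `N` (`S_bot < ℓ < 2η`).  Along the trajectories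
of the gradient-like unit field, `γ` increases strictly inside the band
(`hasDerivAt_gapFn_flow`, `(1 - D) ξ(f) > 0`); the critical points of the band have
`γ(c_j) = -β₀ < 0`.  Hence **every point of `N` flows up to `Y'`** (`exists_flow_mem_level_of_mem`:
otherwise the trajectory would converge to some `c_j` with `γ ≥ 0` along it), and **every point
of `Y'` flows down across `N`** (`hitN_of_mem_level`: backwards `γ` becomes negative, at a
`c_j` or below the band, and the intermediate value theorem applies).  Consequently
`N = π_N(Y')` is a continuous image of the level `Y'` (`range_incl_eq_image_projN`), and
**`N` is connected as soon as `Y'` is** (`connectedSpace_gapLevel`; `Y'` is connected by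
`MorseLevelConnected.lean`).

## References

* D. Gay, R. Kirby, *Trisecting 4-manifolds*, Geom. Topol. 20 (2016), §4, Lemma 14. [GayKirby2016]
* J. Milnor, *Lectures on the h-cobordism theorem* (1965), Thm. 3.4, Thm. 4.1. [MilnorHCobordism1965]
* Y. Matsumoto, *An Introduction to Morse Theory* (2001), §2.3(c). [Matsumoto2001]
-/

open scoped Manifold ContDiff Topology
open Set Function Filter

noncomputable section

universe u

namespace Literature.Topology.FourManifolds

open Flow

/-- Local notation: `𝔼 n` is the model Euclidean space `EuclideanSpace ℝ (Fin n)`. -/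
local notation "𝔼 " n:arg => EuclideanSpace ℝ (Fin n)

variable {X : Type u} [TopologicalSpace X] [T2Space X] [CompactSpace X] [ChartedSpace (𝔼 4) X]
  [IsManifold (𝓡 4) ∞ X]

namespace BiCollar

variable (B : BiCollar X) (Z : B.ZFrame) {η : ℝ} {ι : Type} [Fintype ι] (H : HandleBoxes B.f Z.ζ B.a η ι)
  {h₂ TP χlo χhi : ℝ → ℝ} {Spl Sbot Smin Psw : ℝ}

/-- `γ(c_j) = -β₀` when `T(c_j) = η + β₀`. [folklore] -/
theorem gapFn_cpt {β₀ : ℝ} (hTcpt : ∀ j, H.topHeightBot Z.hζ B.hf B.g h₂ TP χlo χhi Spl Sbot Smin Psw (H.cpt j) = η + β₀) (j : ι) :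
    H.gapFn Z.hζ B.hf B.g h₂ TP χlo χhi Spl Sbot Smin Psw (H.cpt j) = -β₀ := by
  rw [HandleBoxes.gapFn_apply, hTcpt, H.apply_cpt]; ring

/-- **The derivative of `γ` along a trajectory at a band point is positive** (off the critical
points). [cite: GayKirby2016, §4, Lemma 14] -/
theorem hasDerivAt_gapFn_flow_pos
    (hT : ContMDiff (𝓡 4) 𝓘(ℝ, ℝ) ∞ (H.topHeight Z.hζ B.hf B.g h₂ TP χlo χhi Spl Smin Psw))
    (hχlo : ContDiff ℝ ∞ χlo) (hχhi : ContDiff ℝ ∞ χhi)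
    {P₁ v₁ : ℝ} (hPsw0 : 0 < Psw) (hPsw : 2 * Psw ≤ η ^ 2) (hP₁ : 2 * P₁ < Psw)
    (hTP₂ : ∀ P, 2 * P₁ ≤ P → TP P = Spl) (hh₂v : ∀ t ≤ v₁, h₂ t = Spl)
    (hφv : ∀ j (y : RegularLevel B.hf), y.1 ∈ (H.box j).chart.source → H.P j y.1 < 2 * Psw → B.g y ≤ v₁)
    (hD : ∀ z, B.a - η < B.f z → B.f z < B.a + 2 * η →
      H.topCoeffBot Z.hζ B.hf B.g h₂ TP χlo χhi Spl Sbot Smin Psw z ≤ 0)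
    (x : X) (t : ℝ) (hf₁ : B.a - η < B.f (flow B.U.contMDiff x t)) (hf₂ : B.f (flow B.U.contMDiff x t) < B.a + 2 * η)
    (hreg : ¬ IsMCriticalPt (𝓡 4) B.f (flow B.U.contMDiff x t)) :
    ∃ d, 0 < d ∧ HasDerivAt (fun s => H.gapFn Z.hζ B.hf B.g h₂ TP χlo χhi Spl Sbot Smin Psw (flow B.U.contMDiff x s)) d t := by
  have hfM := Z.Fr.isMorse
  have hγd : MDifferentiable (𝓡 4) 𝓘(ℝ, ℝ) (H.gapFn Z.hζ B.hf B.g h₂ TP χlo χhi Spl Sbot Smin Psw) :=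
    (H.contMDiff_gapFn hfM hχlo hT).mdifferentiable (by simp)
  have h1 := hasDerivAt_comp_flow B.U.contMDiff hγd x t
  refine ⟨_, ?_, h1⟩
  show 0 < mlineDeriv (𝓡 4) (H.gapFn Z.hζ B.hf B.g h₂ TP χlo χhi Spl Sbot Smin Psw) (flow B.U.contMDiff x t)
    (B.U.ξ (flow B.U.contMDiff x t))
  rw [Z.mlineDeriv_U_pos_iff, H.mlineDeriv_gapFn_eq Z.hgl hfM hT hχlo hχhi hPsw0 hPsw hP₁ hTP₂ hh₂v hφv hf₁ hf₂]
  exact mul_pos (by linarith [hD _ hf₁ hf₂]) (Z.hgl.mlineDeriv_pos _ hreg)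

/-- **Every point of `N` flows up to the level `a + ℓ`** (`S_bot < ℓ < 2η`). [cite: MilnorHCobordism1965, Thm. 3.4] -/
theorem exists_flow_mem_level_of_mem
    (hT : ContMDiff (𝓡 4) 𝓘(ℝ, ℝ) ∞ (H.topHeight Z.hζ B.hf B.g h₂ TP χlo χhi Spl Smin Psw))
    (hχlo : ContDiff ℝ ∞ χlo) (hχhi : ContDiff ℝ ∞ χhi)
    {P₁ v₁ : ℝ} (hPsw0 : 0 < Psw) (hPsw : 2 * Psw ≤ η ^ 2) (hP₁ : 2 * P₁ < Psw)
    (hTP₂ : ∀ P, 2 * P₁ ≤ P → TP P = Spl) (hh₂v : ∀ t ≤ v₁, h₂ t = Spl)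
    (hφv : ∀ j (y : RegularLevel B.hf), y.1 ∈ (H.box j).chart.source → H.P j y.1 < 2 * Psw → B.g y ≤ v₁)
    (hD : ∀ z, B.a - η < B.f z → B.f z < B.a + 2 * η →
      H.topCoeffBot Z.hζ B.hf B.g h₂ TP χlo χhi Spl Sbot Smin Psw z ≤ 0)
    (hTmem : ∀ z, H.topHeightBot Z.hζ B.hf B.g h₂ TP χlo χhi Spl Sbot Smin Psw z ∈ Icc (-Smin) Sbot)
    (hSmin : Smin < η / 2) {β₀ : ℝ} (hβ₀ : 0 < β₀)
    (hTcpt : ∀ j, H.topHeightBot Z.hζ B.hf B.g h₂ TP χlo χhi Spl Sbot Smin Psw (H.cpt j) = η + β₀)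
    {ℓ : ℝ} (hℓ₁ : Sbot < ℓ) (hℓ₂ : ℓ < 2 * η) {z : X}
    (hz : H.gapFn Z.hζ B.hf B.g h₂ TP χlo χhi Spl Sbot Smin Psw z = 0) :
    ∃ t, 0 ≤ t ∧ B.f (flow B.U.contMDiff z t) = B.a + ℓ := by
  have hfM := Z.Fr.isMorse
  have hgl := Z.Fr.isGradientLike
  have hη := H.eta_pos
  have hcontf : Continuous B.f := hfM.contMDiff.continuous
  have hcontγ : Continuous (H.gapFn Z.hζ B.hf B.g h₂ TP χlo χhi Spl Sbot Smin Psw) := (H.contMDiff_gapFn hfM hχlo hT).continuous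
  have hcfl : Continuous (flow B.U.contMDiff z) := continuous_flow B.U.contMDiff z
  obtain ⟨hl, hu⟩ := hTmem z
  have hs : B.f z - B.a = H.topHeightBot Z.hζ B.hf B.g h₂ TP χlo χhi Spl Sbot Smin Psw z := by
    rw [HandleBoxes.gapFn_apply] at hz; linarith
  have hfz₁ : B.a - η < B.f z := by linarith
  have hfz₂ : B.f z < B.a + ℓ := by linarith
  -- `z` is not critical
  have hzreg : ¬ IsMCriticalPt (𝓡 4) B.f z := by
    intro hc
    obtain ⟨j, hj⟩ := H.crit_val z hc hfz₁.le (by linarith)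
    have := B.gapFn_cpt Z H hTcpt j
    rw [← hj, hz] at this; linarith
  by_contra hnot
  push Not at hnot
  -- the forward trajectory stays below `a + ℓ`
  have hbelow : ∀ t, 0 ≤ t → B.f (flow B.U.contMDiff z t) < B.a + ℓ := by
    intro t ht
    by_contra hge; push Not at hge
    obtain ⟨s, hs, hfs⟩ := intermediate_value_Icc ht (hcontf.comp hcfl).continuousOn
      ⟨by show B.f (flow B.U.contMDiff z 0) ≤ B.a + ℓ; rw [flow_zero]; exact hfz₂.le, hge⟩
    exact hnot s hs.1 hfs
  have hmono_f : Monotone (B.f ∘ flow B.U.contMDiff z) := hgl.monotone_comp_flow hfM B.U.contMDiff z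
  have habove : ∀ t, 0 ≤ t → B.a - η < B.f (flow B.U.contMDiff z t) := fun t ht =>
    lt_of_lt_of_le hfz₁ (by have := hmono_f ht; simpa [flow_zero] using this)
  -- `γ ∘ flow` is strictly increasing on `[0, ∞)`
  have hreg_t : ∀ t, ¬ IsMCriticalPt (𝓡 4) B.f (flow B.U.contMDiff z t) := fun t => hgl.not_isMCriticalPt_flow B.U.contMDiff hzreg t
  have hmono : StrictMonoOn (fun s => H.gapFn Z.hζ B.hf B.g h₂ TP χlo χhi Spl Sbot Smin Psw (flow B.U.contMDiff z s)) (Ici 0) := by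
    refine strictMonoOn_of_deriv_pos (convex_Ici 0) ((hcontγ.comp hcfl).continuousOn) fun t ht => ?_
    rw [interior_Ici] at ht
    obtain ⟨d, hd, hdt⟩ := B.hasDerivAt_gapFn_flow_pos Z H hT hχlo hχhi hPsw0 hPsw hP₁ hTP₂ hh₂v hφv hD z t
      (habove t ht.le) (by linarith [hbelow t ht.le]) (hreg_t t)
    rw [hdt.deriv]; exact hd
  have hpos : ∀ t, 0 < t → 0 < H.gapFn Z.hζ B.hf B.g h₂ TP χlo χhi Spl Sbot Smin Psw (flow B.U.contMDiff z t) := by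
    intro t ht
    have := hmono (Set.mem_Ici.2 le_rfl) ht.le ht
    simp only [flow_zero, hz] at this
    exact this
  -- the limit critical point is some `c_j`, where `γ = -β₀ < 0`
  obtain ⟨r, hrc, hlim⟩ := hgl.exists_isMCriticalPt_tendsto_flow_atTop hfM B.U.contMDiff z
  have hγlim : Tendsto (fun t => H.gapFn Z.hζ B.hf B.g h₂ TP χlo χhi Spl Sbot Smin Psw (flow B.U.contMDiff z t)) atTop
      (𝓝 (H.gapFn Z.hζ B.hf B.g h₂ TP χlo χhi Spl Sbot Smin Psw r)) := hcontγ.continuousAt.tendsto.comp hlim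
  have hflim : Tendsto (fun t => B.f (flow B.U.contMDiff z t)) atTop (𝓝 (B.f r)) := hcontf.continuousAt.tendsto.comp hlim
  have hfr₁ : B.f z ≤ B.f r :=
    ge_of_tendsto hflim ((eventually_ge_atTop 0).mono fun t ht => by have := hmono_f ht; simpa [flow_zero] using this)
  have hfr₂ : B.f r ≤ B.a + ℓ := le_of_tendsto hflim ((eventually_ge_atTop 0).mono fun t ht => (hbelow t ht).le)
  obtain ⟨j, hj⟩ := H.crit_val r hrc (by linarith) (by linarith)
  have hγr : H.gapFn Z.hζ B.hf B.g h₂ TP χlo χhi Spl Sbot Smin Psw r = -β₀ := by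
    rw [hj]; exact B.gapFn_cpt Z H hTcpt j
  have hge : 0 ≤ H.gapFn Z.hζ B.hf B.g h₂ TP χlo χhi Spl Sbot Smin Psw r :=
    ge_of_tendsto hγlim ((eventually_gt_atTop 0).mono fun t ht => (hpos t ht).le)
  linarith

/-- **Every point of the level `a + ℓ` flows down across `N`.** [cite: MilnorHCobordism1965, Thm. 3.4] -/
theorem hitN_of_mem_level
    (hT : ContMDiff (𝓡 4) 𝓘(ℝ, ℝ) ∞ (H.topHeight Z.hζ B.hf B.g h₂ TP χlo χhi Spl Smin Psw))
    (hχlo : ContDiff ℝ ∞ χlo)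
    (hTmem : ∀ z, H.topHeightBot Z.hζ B.hf B.g h₂ TP χlo χhi Spl Sbot Smin Psw z ∈ Icc (-Smin) Sbot)
    (hSmin : Smin < η / 2) {β₀ : ℝ} (hβ₀ : 0 < β₀)
    (hTcpt : ∀ j, H.topHeightBot Z.hζ B.hf B.g h₂ TP χlo χhi Spl Sbot Smin Psw (H.cpt j) = η + β₀)
    {ℓ : ℝ} (hℓ₁ : Sbot < ℓ) (hℓ₂ : ℓ < 2 * η) {y : X} (hy : B.f y = B.a + ℓ) :
    B.HitN (H.gapFn Z.hζ B.hf B.g h₂ TP χlo χhi Spl Sbot Smin Psw) y := by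
  have hfM := Z.Fr.isMorse
  have hgl := Z.Fr.isGradientLike
  have hη := H.eta_pos
  have hcontf : Continuous B.f := hfM.contMDiff.continuous
  have hcontγ : Continuous (H.gapFn Z.hζ B.hf B.g h₂ TP χlo χhi Spl Sbot Smin Psw) := (H.contMDiff_gapFn hfM hχlo hT).continuous
  have hcfl : Continuous (flow B.U.contMDiff y) := continuous_flow B.U.contMDiff y
  set γ := H.gapFn Z.hζ B.hf B.g h₂ TP χlo χhi Spl Sbot Smin Psw with hγdef
  -- `γ(y) > 0`
  have hγy : 0 < γ y := by
    obtain ⟨-, hu⟩ := hTmem y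
    rw [hγdef, HandleBoxes.gapFn_apply, hy]; linarith
  -- somewhere backwards `γ < 0`
  have hneg : ∃ t, t ≤ 0 ∧ γ (flow B.U.contMDiff y t) < 0 := by
    obtain ⟨r, hrc, hlim⟩ := hgl.exists_isMCriticalPt_tendsto_flow_atBot hfM B.U.contMDiff y
    have hγlim : Tendsto (fun t => γ (flow B.U.contMDiff y t)) atBot (𝓝 (γ r)) := hcontγ.continuousAt.tendsto.comp hlim
    have hflim : Tendsto (fun t => B.f (flow B.U.contMDiff y t)) atBot (𝓝 (B.f r)) := hcontf.continuousAt.tendsto.comp hlim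
    have hmono_f : Monotone (B.f ∘ flow B.U.contMDiff y) := hgl.monotone_comp_flow hfM B.U.contMDiff y
    have hfr : B.f r ≤ B.f y :=
      le_of_tendsto hflim ((eventually_le_atBot 0).mono fun t ht => by have := hmono_f ht; simpa [flow_zero] using this)
    by_cases hr : B.a - η ≤ B.f r
    · -- the limit is some `c_j`
      have hfr2 : B.f r < B.a + 2 * η := by linarith
      obtain ⟨j, hj⟩ := H.crit_val r hrc hr hfr2
      have hγr : γ r = -β₀ := by rw [hj]; exact B.gapFn_cpt Z H hTcpt j
      have hev : ∀ᶠ t in atBot, γ (flow B.U.contMDiff y t) < 0 := hγlim.eventually (Iio_mem_nhds (by rw [hγr]; linarith))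
      obtain ⟨t, ht, ht0⟩ := (hev.and (eventually_le_atBot 0)).exists
      exact ⟨t, ht0, ht⟩
    · -- the trajectory goes below the band
      push Not at hr
      have hev : ∀ᶠ t in atBot, B.f (flow B.U.contMDiff y t) < B.a - η / 2 := hflim.eventually (Iio_mem_nhds (by linarith))
      obtain ⟨t, ht, ht0⟩ := (hev.and (eventually_le_atBot 0)).exists
      refine ⟨t, ht0, ?_⟩
      obtain ⟨hl, -⟩ := hTmem (flow B.U.contMDiff y t)
      show H.gapFn Z.hζ B.hf B.g h₂ TP χlo χhi Spl Sbot Smin Psw (flow B.U.contMDiff y t) < 0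
      rw [HandleBoxes.gapFn_apply]; linarith
  obtain ⟨t, ht0, hγt⟩ := hneg
  obtain ⟨s, -, hs⟩ := intermediate_value_Icc ht0 (hcontγ.comp hcfl).continuousOn
    ⟨hγt.le, by rw [comp_apply, show flow B.U.contMDiff y 0 = y from flow_zero B.U.contMDiff y]; exact hγy.le⟩
  exact ⟨s, hs⟩

/-- **`N` is the image of the level `a + ℓ` under the projection `π_N`.** [cite: MilnorHCobordism1965, Thm. 4.1] -/
theorem setOf_gapFn_eq_image_projN
    (hT : ContMDiff (𝓡 4) 𝓘(ℝ, ℝ) ∞ (H.topHeight Z.hζ B.hf B.g h₂ TP χlo χhi Spl Smin Psw))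
    (hχlo : ContDiff ℝ ∞ χlo) (hχhi : ContDiff ℝ ∞ χhi)
    {P₁ v₁ : ℝ} (hPsw0 : 0 < Psw) (hPsw : 2 * Psw ≤ η ^ 2) (hP₁ : 2 * P₁ < Psw)
    (hTP₂ : ∀ P, 2 * P₁ ≤ P → TP P = Spl) (hh₂v : ∀ t ≤ v₁, h₂ t = Spl)
    (hφv : ∀ j (y : RegularLevel B.hf), y.1 ∈ (H.box j).chart.source → H.P j y.1 < 2 * Psw → B.g y ≤ v₁)
    (hD : ∀ z, B.a - η < B.f z → B.f z < B.a + 2 * η →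
      H.topCoeffBot Z.hζ B.hf B.g h₂ TP χlo χhi Spl Sbot Smin Psw z ≤ 0)
    (hTmem : ∀ z, H.topHeightBot Z.hζ B.hf B.g h₂ TP χlo χhi Spl Sbot Smin Psw z ∈ Icc (-Smin) Sbot)
    (hSmin : Smin < η / 2) {β₀ : ℝ} (hβ₀ : 0 < β₀)
    (hTcpt : ∀ j, H.topHeightBot Z.hζ B.hf B.g h₂ TP χlo χhi Spl Sbot Smin Psw (H.cpt j) = η + β₀)
    {ℓ : ℝ} (hℓ₁ : Sbot < ℓ) (hℓ₂ : ℓ < 2 * η)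
    (htr : ∀ x, H.gapFn Z.hζ B.hf B.g h₂ TP χlo χhi Spl Sbot Smin Psw x = 0 →
      0 < mlineDeriv (𝓡 4) (H.gapFn Z.hζ B.hf B.g h₂ TP χlo χhi Spl Sbot Smin Psw) x (B.U.ξ x)) :
    {z : X | H.gapFn Z.hζ B.hf B.g h₂ TP χlo χhi Spl Sbot Smin Psw z = 0} =
      B.projN (H.gapFn Z.hζ B.hf B.g h₂ TP χlo χhi Spl Sbot Smin Psw) '' (B.f ⁻¹' {B.a + ℓ}) := by
  have hfM := Z.Fr.isMorse
  have hγs : ContMDiff (𝓡 4) 𝓘(ℝ, ℝ) ∞ (H.gapFn Z.hζ B.hf B.g h₂ TP χlo χhi Spl Sbot Smin Psw) := H.contMDiff_gapFn hfM hχlo hT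
  ext z
  constructor
  · intro hz
    obtain ⟨t, -, ht⟩ := B.exists_flow_mem_level_of_mem Z H hT hχlo hχhi hPsw0 hPsw hP₁ hTP₂ hh₂v hφv hD hTmem hSmin hβ₀ hTcpt hℓ₁ hℓ₂ hz
    refine ⟨flow B.U.contMDiff z t, ht, ?_⟩
    have hzN : B.HitN (H.gapFn Z.hζ B.hf B.g h₂ TP χlo χhi Spl Sbot Smin Psw) z :=
      hits_of_apply_eq (B.isSmoothFlow_θU.map_zero _) hz
    change B.projN _ (B.U.fl z t) = z
    rw [B.projN_fl hγs htr hzN, B.projN_of_apply_eq hγs htr hz]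
  · rintro ⟨y, hy, rfl⟩
    exact B.apply_projN (B.hitN_of_mem_level Z H hT hχlo hTmem hSmin hβ₀ hTcpt hℓ₁ hℓ₂ hy)

/-- **`N` is connected when the level `Y' = f⁻¹(a + ℓ)` is.** [cite: GayKirby2016, §4, Lemma 14] -/
theorem connectedSpace_gapLevel
    (hT : ContMDiff (𝓡 4) 𝓘(ℝ, ℝ) ∞ (H.topHeight Z.hζ B.hf B.g h₂ TP χlo χhi Spl Smin Psw))
    (hχlo : ContDiff ℝ ∞ χlo) (hχhi : ContDiff ℝ ∞ χhi)
    {P₁ v₁ : ℝ} (hPsw0 : 0 < Psw) (hPsw : 2 * Psw ≤ η ^ 2) (hP₁ : 2 * P₁ < Psw)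
    (hTP₂ : ∀ P, 2 * P₁ ≤ P → TP P = Spl) (hh₂v : ∀ t ≤ v₁, h₂ t = Spl)
    (hφv : ∀ j (y : RegularLevel B.hf), y.1 ∈ (H.box j).chart.source → H.P j y.1 < 2 * Psw → B.g y ≤ v₁)
    (hD : ∀ z, B.a - η < B.f z → B.f z < B.a + 2 * η →
      H.topCoeffBot Z.hζ B.hf B.g h₂ TP χlo χhi Spl Sbot Smin Psw z ≤ 0)
    (hTmem : ∀ z, H.topHeightBot Z.hζ B.hf B.g h₂ TP χlo χhi Spl Sbot Smin Psw z ∈ Icc (-Smin) Sbot)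
    (hSmin : Smin < η / 2) {β₀ : ℝ} (hβ₀ : 0 < β₀)
    (hTcpt : ∀ j, H.topHeightBot Z.hζ B.hf B.g h₂ TP χlo χhi Spl Sbot Smin Psw (H.cpt j) = η + β₀)
    {ℓ : ℝ} (hℓ₁ : Sbot < ℓ) (hℓ₂ : ℓ < 2 * η)
    (htr : ∀ x, H.gapFn Z.hζ B.hf B.g h₂ TP χlo χhi Spl Sbot Smin Psw x = 0 →
      0 < mlineDeriv (𝓡 4) (H.gapFn Z.hζ B.hf B.g h₂ TP χlo χhi Spl Sbot Smin Psw) x (B.U.ξ x))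
    (hγ : IsRegularLevel (𝓡 4) (H.gapFn Z.hζ B.hf B.g h₂ TP χlo χhi Spl Sbot Smin Psw) 0)
    (hℓ : IsRegularLevel (𝓡 4) B.f (B.a + ℓ)) [ConnectedSpace (RegularLevel hℓ)] : ConnectedSpace (RegularLevel hγ) := by
  have hfM := Z.Fr.isMorse
  have hγs : ContMDiff (𝓡 4) 𝓘(ℝ, ℝ) ∞ (H.gapFn Z.hζ B.hf B.g h₂ TP χlo χhi Spl Sbot Smin Psw) := H.contMDiff_gapFn hfM hχlo hT
  have hlev : IsConnected (B.f ⁻¹' {B.a + ℓ}) := by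
    rw [← RegularLevel.range_incl hℓ]
    exact isConnected_range (RegularLevel.isEmbedding_incl hℓ).continuous
  have hcont : ContinuousOn (B.projN (H.gapFn Z.hζ B.hf B.g h₂ TP χlo χhi Spl Sbot Smin Psw)) (B.f ⁻¹' {B.a + ℓ}) :=
    fun y hy => (B.contMDiffAt_projN hγs htr
      (B.hitN_of_mem_level Z H hT hχlo hTmem hSmin hβ₀ hTcpt hℓ₁ hℓ₂ hy)).continuousAt.continuousWithinAt
  have himg := hlev.image _ hcont
  rw [← B.setOf_gapFn_eq_image_projN Z H hT hχlo hχhi hPsw0 hPsw hP₁ hTP₂ hh₂v hφv hD hTmem hSmin hβ₀ hTcpt hℓ₁ hℓ₂ htr] at himg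
  exact isConnected_iff_connectedSpace.1 himg


end BiCollar

end Literature.Topology.FourManifolds

end
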